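import Summits.AtomisticToContinuum.Crystallization.Theorems.FreeSplittingCertificatesRadiusLadder
import Literature.MathematicalPhysics.StatisticalMechanics.PeriodicConfigurationSums

/-!
# `FiniteRangeSplitting` (stmt-AtomisticToContinuum-12559): periodic fragments never refute — the half rule

Companion of `FreeSplittingCertificatesRadiusLadder` (block-2b unit `b2b-freesplit-A`, gen 6).  VALUE = a theorem
retiring an infinite FAMILY of candidate refuters of the radius ladder (RESULTS-R2 §6 P2b / P5 made kernel-checked
for the attractive vertex-transitive periodic family) — NOT summit progress; nothing here closes an item.

A rung `RungAt δ R` is refuted by a finite zoo of configurations on which NO rule is feasible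
(`not_rungAt_of_zoo`).  Here: at EVERY radius `R`, the naive half rule `Φ ≡ 1/2` is feasible at every site of
every finite fragment `x ⊆ F + G` of a periodic configuration `P` of `ℝ³` that is

* ATTRACTIVE — every realised pair distance lies in the attractive region of the potential
  (`V_LJ(dist z z') ≤ 0` for distinct points, i.e. all distances `≥ 2^{-1/6}`;
  `attractive_of_one_le_dist` for distances `≥ 1`), and
* SITE-HOMOGENEOUS — all motif points have the same site lattice sum `latticeSiteSum P y = Σ'_{z ≠ y} V(|y - z|)`
  (automatic for a Bravais lattice, `#F = 1`; for hcp-like multi-lattices it is the vertex-transitivity of the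
  point set, to be supplied by the user),

because `e_∞ ≤ e(P)` (`PeriodicUpperBound`, `periodicUpperBound_proof`, in the tree),
`e(P) = ½ · latticeSiteSum P y` at every point of a site-homogeneous `P` (translation invariance
`latticeSiteSum_add`), and dropping the non-positive terms of the absolutely convergent lattice sum outside the
fragment only INCREASES it:
`½ latticeSiteSum P (x i) ≤ ½ Σ_{j ≠ i} V(r_ij) = siteE R (1/2) x i`.

* `halfRule`, `isRule_halfRule`, `siteE_halfRule`; `latticeSiteSum`, `latticeSiteSum_add`
  (lattice translations preserve site sums), `energyPerParticle_eq_latticeSiteSum` (site-homogeneous `P`: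
  `e(P) = latticeSiteSum/2` at every point), `latticeSiteSum_le_sum_of_attractive` (the finite fragment bound);
* `halfRule_feasibleOn_periodic` — the theorem; `halfRule_feasibleOn_bravais` — the Bravais case
  (`P.motif.card = 1`, no homogeneity hypothesis); `not_refuting_of_periodic_fragments` — hence a zoo all of
  whose configurations are fragments of such periodic configurations (any mixture of lattices, radii, shapes)
  is never in the hypothesis shape of `not_rungAt_of_zoo`, at any `R`.

So the whole "balls / slabs / arbitrary finite pieces of attractive Bravais lattices" family (RESULTS-R2 §2 zoo
families P3/P5 at `a ≥ 2^{-1/6}`) is dead as a stand-alone refuter of every rung, before any LP is run; such rows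
can only ever matter in combination with non-periodic rows sharing their realised keys
(`…RadiusLadderRecurrence`).
-/

noncomputable section
namespace Summit.AtomisticToContinuum.Crystallization.Theorems.StrictSplittingRuleBirth

open scoped BigOperators Classical
open Literature.MathematicalPhysics.StatisticalMechanics

/-- Euclidean `3`-space. -/
local notation "E3" => EuclideanSpace ℝ (Fin 3)

/-! ## The half rule -/

/-- The naive half rule `Φ ≡ 1/2` (every bond split evenly). [folklore] -/
def halfRule : E3 → Finset E3 → ℝ := fun _ _ => 1 / 2

/-- The half rule is a rule (`stub_defs`). -/
theorem isRule_halfRule : IsRule halfRule := stub_defs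

/-- The half rule's site energy is half the pair sum of the site, at every radius. -/
theorem siteE_halfRule (R : ℝ) {N : ℕ} (x : Fin N → E3) (i : Fin N) :
    siteE R halfRule x i = (∑ j ∈ Finset.univ.erase i, lennardJones (dist (x i) (x j))) / 2 := by
  rw [perturbative_siteE_eq, Finset.sum_div]
  refine Finset.sum_congr rfl fun j _ => ?_
  simp only [halfRule]
  ring

/-! ## Site lattice sums of a periodic configuration -/

/-- The site lattice sum `Σ'_{z ∈ F+G, z ≠ p} V_LJ(|p - z|)` of a periodic configuration at a point `p`
(absolutely convergent in `ℝ³`, `PeriodicConfiguration.summable_lennardJones_dist_three`). [folklore] -/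
def latticeSiteSum (P : PeriodicConfiguration 3) (p : E3) : ℝ :=
  ∑' z : {z : E3 // z ∈ P.points ∧ z ≠ p}, lennardJones (dist p z.1)

/-- The energy per particle is the motif average of half the site sums (definitional). -/
theorem energyPerParticle_eq_sum_latticeSiteSum (P : PeriodicConfiguration 3) :
    P.energyPerParticle lennardJones = (2 * (P.motif.card : ℝ))⁻¹ * ∑ y ∈ P.motif, latticeSiteSum P y := rfl

/-- **Lattice translations preserve site sums**: `latticeSiteSum P (p + g) = latticeSiteSum P p` for `g ∈ G`. -/
theorem latticeSiteSum_add (P : PeriodicConfiguration 3) (p : E3) {g : E3} (hg : g ∈ P.lattice) :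
    latticeSiteSum P (p + g) = latticeSiteSum P p := by
  let e : {z : E3 // z ∈ P.points ∧ z ≠ p} ≃ {z : E3 // z ∈ P.points ∧ z ≠ p + g} :=
    { toFun := fun z => ⟨z.1 + g, P.add_mem_points z.2.1 hg, fun h => z.2.2 (add_right_cancel h)⟩
      invFun := fun z => ⟨z.1 + -g, P.add_mem_points z.2.1 (P.lattice.neg_mem hg), fun h => z.2.2 (by
        rw [← sub_eq_add_neg] at h
        exact eq_add_of_sub_eq h)⟩
      left_inv := fun z => Subtype.ext (by simp)
      right_inv := fun z => Subtype.ext (by simp) }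
  unfold latticeSiteSum
  rw [← Equiv.tsum_eq e]
  refine tsum_congr fun z => ?_
  show lennardJones (dist (p + g) (z.1 + g)) = lennardJones (dist p z.1)
  rw [dist_add_right]

/-- Site sums are constant on each sublattice: at a point `p = y + g` the site sum is that of its motif
representative `y`. -/
theorem latticeSiteSum_eq_of_mem_points (P : PeriodicConfiguration 3) {p : E3} (hp : p ∈ P.points) :
    ∃ y ∈ P.motif, latticeSiteSum P p = latticeSiteSum P y := by
  obtain ⟨y, hy, g, hg, rfl⟩ := hp
  exact ⟨y, hy, latticeSiteSum_add P y hg⟩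

/-- **Site-homogeneous periodic configurations**: if all motif points have the same site sum, then
`e(P) = ½ · latticeSiteSum P p` at EVERY point `p` of the configuration. -/
theorem energyPerParticle_eq_latticeSiteSum (P : PeriodicConfiguration 3)
    (hhom : ∀ y ∈ P.motif, ∀ y' ∈ P.motif, latticeSiteSum P y = latticeSiteSum P y') {p : E3}
    (hp : p ∈ P.points) : P.energyPerParticle lennardJones = latticeSiteSum P p / 2 := by
  obtain ⟨y, hy, hpy⟩ := latticeSiteSum_eq_of_mem_points P hp
  rw [energyPerParticle_eq_sum_latticeSiteSum, hpy,
    Finset.sum_congr rfl fun y' hy' => hhom y' hy' y hy, Finset.sum_const, nsmul_eq_mul]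
  have hF : (P.motif.card : ℝ) ≠ 0 := Nat.cast_ne_zero.2 (Finset.card_pos.2 P.motif_nonempty).ne'
  field_simp

/-- In a Bravais lattice (`#F = 1`) site-homogeneity is automatic. -/
theorem latticeSiteSum_hom_of_bravais (P : PeriodicConfiguration 3) (hP : P.motif.card = 1) :
    ∀ y ∈ P.motif, ∀ y' ∈ P.motif, latticeSiteSum P y = latticeSiteSum P y' := by
  intro y hy y' hy'
  rw [Finset.card_eq_one.1 hP |>.choose_spec] at hy hy'
  rw [Finset.mem_singleton] at hy hy'
  rw [hy, hy']

/-! ## The finite fragment bound and the theorem -/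

/-- **Dropping the attractive tail**: for a finite injective fragment `x ⊆ F+G` of an ATTRACTIVE periodic
configuration (every realised pair energy `≤ 0`), the site sum at `x i` is at most the finite pair sum
`Σ_{j ≠ i} V(r_ij)` — the omitted terms are `≤ 0` and the lattice sum converges absolutely. -/
theorem latticeSiteSum_le_sum_of_attractive (P : PeriodicConfiguration 3)
    (hV : ∀ z ∈ P.points, ∀ z' ∈ P.points, z ≠ z' → lennardJones (dist z z') ≤ 0) {N : ℕ}
    {x : Fin N → E3} (hx : Function.Injective x) (hxP : ∀ i, x i ∈ P.points) (i : Fin N) :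
    latticeSiteSum P (x i) ≤ ∑ j ∈ Finset.univ.erase i, lennardJones (dist (x i) (x j)) := by
  set f : {z : E3 // z ∈ P.points ∧ z ≠ x i} → ℝ := fun z => lennardJones (dist (x i) z.1) with hf
  have hsum : Summable f := P.summable_lennardJones_dist_three (x i)
  have hnp : ∀ z, f z ≤ 0 := fun z => hV _ (hxP i) _ z.2.1 (Ne.symm z.2.2)
  let emb : {j // j ∈ Finset.univ.erase i} ↪ {z : E3 // z ∈ P.points ∧ z ≠ x i} :=
    ⟨fun j => ⟨x j.1, hxP j.1, hx.ne (Finset.ne_of_mem_erase j.2)⟩, fun j j' h =>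
      Subtype.ext (hx (congrArg (fun z : {z : E3 // z ∈ P.points ∧ z ≠ x i} => z.1) h))⟩
  have hfin : ∑ z ∈ (Finset.univ.erase i).attach.map emb, f z =
      ∑ j ∈ Finset.univ.erase i, lennardJones (dist (x i) (x j)) := by
    rw [Finset.sum_map]
    exact Finset.sum_attach (Finset.univ.erase i) fun j => lennardJones (dist (x i) (x j))
  have hle : ∑ z ∈ (Finset.univ.erase i).attach.map emb, (-f z) ≤ ∑' z, (-f z) :=
    Summable.sum_le_tsum _ (fun z _ => neg_nonneg.2 (hnp z)) hsum.neg
  rw [Finset.sum_neg_distrib, tsum_neg, hfin] at hle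
  show ∑' z, f z ≤ _
  linarith

/-- **Periodic fragments never refute (half rule).**  For an attractive, site-homogeneous periodic
configuration `P` of `ℝ³`, the half rule is feasible — `e_∞ ≤ siteE R (1/2) x i` — at every site of every
finite injective fragment `x ⊆ F + G`, at every radius `R`. -/
theorem halfRule_feasibleOn_periodic (P : PeriodicConfiguration 3)
    (hhom : ∀ y ∈ P.motif, ∀ y' ∈ P.motif, latticeSiteSum P y = latticeSiteSum P y')
    (hV : ∀ z ∈ P.points, ∀ z' ∈ P.points, z ≠ z' → lennardJones (dist z z') ≤ 0) (R : ℝ) {N : ℕ}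
    {x : Fin N → E3} (hx : Function.Injective x) (hxP : ∀ i, x i ∈ P.points) (i : Fin N) :
    eInf ≤ siteE R halfRule x i := by
  have hub : eInf ≤ P.energyPerParticle lennardJones := periodicUpperBound_proof P
  rw [energyPerParticle_eq_latticeSiteSum P hhom (hxP i)] at hub
  rw [siteE_halfRule]
  have h := latticeSiteSum_le_sum_of_attractive P hV hx hxP i
  linarith

/-- **Bravais fragments never refute**: the case `#F = 1` (no homogeneity hypothesis), e.g. every finite piece
of every Bravais lattice all of whose distances are `≥ 2^{-1/6}`. -/
theorem halfRule_feasibleOn_bravais (P : PeriodicConfiguration 3) (hP : P.motif.card = 1)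
    (hV : ∀ z ∈ P.points, ∀ z' ∈ P.points, z ≠ z' → lennardJones (dist z z') ≤ 0) (R : ℝ) {N : ℕ}
    {x : Fin N → E3} (hx : Function.Injective x) (hxP : ∀ i, x i ∈ P.points) (i : Fin N) :
    eInf ≤ siteE R halfRule x i :=
  halfRule_feasibleOn_periodic P (latticeSiteSum_hom_of_bravais P hP) hV R hx hxP i

/-- The distance form of attractivity: all distinct points at distance `≥ 1` (`lennardJones_nonpos`; the sharp
region `r⁶ ≥ 1/2`, i.e. `r ≥ 2^{-1/6}`, is `OnePercentFccRung.lennardJones_nonpos_of_half_le` of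
`…ThreeConeCertificateOnePercentCertificateFccRung`, usable in `hV` verbatim). -/
theorem attractive_of_one_le_dist (P : PeriodicConfiguration 3)
    (hfar : ∀ z ∈ P.points, ∀ z' ∈ P.points, z ≠ z' → 1 ≤ dist z z') :
    ∀ z ∈ P.points, ∀ z' ∈ P.points, z ≠ z' → lennardJones (dist z z') ≤ 0 :=
  fun z hz z' hz' hne => lennardJones_nonpos (hfar z hz z' hz' hne)

/-- **A zoo of periodic fragments is never refuting.**  If every configuration of a zoo `Z` is an injective
fragment of some attractive site-homogeneous periodic configuration (the configurations may come from different
lattices), then the half rule is feasible on all of `Z` at every radius, so `Z` is never in the hypothesis shape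
of `not_rungAt_of_zoo`. -/
theorem not_refuting_of_periodic_fragments (R : ℝ) (Z : Finset (Σ N : ℕ, Fin N → E3))
    (hZ : ∀ c ∈ Z, Function.Injective c.2 ∧ ∃ P : PeriodicConfiguration 3,
        (∀ y ∈ P.motif, ∀ y' ∈ P.motif, latticeSiteSum P y = latticeSiteSum P y') ∧
        (∀ z ∈ P.points, ∀ z' ∈ P.points, z ≠ z' → lennardJones (dist z z') ≤ 0) ∧
        ∀ i, c.2 i ∈ P.points) :
    ¬ ∀ Φ : E3 → Finset E3 → ℝ, IsRule Φ → ∃ c ∈ Z, ∃ i : Fin c.1, siteE R Φ c.2 i < eInf := by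
  intro href
  obtain ⟨c, hc, i, hlt⟩ := href halfRule isRule_halfRule
  obtain ⟨hx, P, hhom, hV, hxP⟩ := hZ c hc
  exact (not_lt.2 (halfRule_feasibleOn_periodic P hhom hV R hx hxP i)) hlt

end Summit.AtomisticToContinuum.Crystallization.Theorems.StrictSplittingRuleBirth

end
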